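import Literature.MathematicalPhysics.QuantumLattice.SchwartzTensorDensityProofs
import Literature.MathematicalPhysics.QuantumLattice.SchwartzLocalDensity
import Literature.MathematicalPhysics.QuantumLattice.EuclideanAction
import HarnessLib

/-!
# Windowed tensor products are dense in the time-ordered test functions

Stub `stub_windowedDensity` of the line `positivity-disc-to-operator-cone` (crux
`MirrorModularBoosts.PlanarSpectralCone`, second lead): every time-ordered `n`-point test function
on `(ℝ⁴)ⁿ` (support in the open chamber `{0 < x₁⁰ < ⋯ < xₙ⁰}`) lies in the closure, in the
Schwartz topology, of the `ℂ`-span of the WINDOWED TENSOR PRODUCTS `f₁ ⊗ ⋯ ⊗ fₙ`, factor `i`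
supported in a slab `{aᵢ ≤ x⁰ ≤ bᵢ, |x¹| ≤ ρ}` with `0 < aᵢ` and `bᵢ < aⱼ` for `i < j`.

Proof (pure Schwartz-space bookkeeping on top of the tree's local density theorem):
compact cutoffs (`exists_tsupport_subset_inter_closedBall_tendsto`) reduce to compactly supported
functions; a compact subset of the open chamber keeps a uniform room `δ > 0` from its walls
(`exists_chamber_room`, from `IsCompact.exists_forall_le'` constraint by constraint); the scaled
lattice partition of unity of `SchwartzPartition` / `SchwartzLocalDensity` with bump supports of
diameter `< δ / 5` writes the function as a finite sum of pieces, each supported in a closed box of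
half-side `δ / 5` around a point of the chamber, strictly inside an open ORDERED box of half-side
`2δ / 5`; the local density theorem `mem_closure_span_boxTensors` (block coordinates = the four
coordinates of each point) puts each piece in the closed span of that box's tensor products, which
are windowed tensor products (`mem_closure_span_windowed_of_box`); and the closure of a submodule
is closed under finite sums.
-/

noncomputable section

namespace Summit.QuantumFields.YangMills.Cruxes.PlanarSpectralCone.PositivityDiscToOperatorCone

open MeasureTheory Filter Set Metric
open scoped InnerProductSpace SchwartzMap Topology
open Literature.MathematicalPhysics.QuantumLattice

-- Euclidean `ℝ⁴` (the skeleton's notation: the stub's signature must match the registered text).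
local notation "E4" => EuclideanSpace ℝ (Fin 4)

/-- **Uniform room in the chamber.** A compact subset `K` of the open chamber
`{0 < x₁⁰ < ⋯ < xₙ⁰}` keeps a uniform distance `δ > 0` from its walls: `δ ≤ yᵢ⁰` and
`δ ≤ yⱼ⁰ - yᵢ⁰` (`i < j`) for `y ∈ K` (a positive continuous function on a compact set is
bounded below by a positive constant, `IsCompact.exists_forall_le'`; finitely many constraints are
combined along the filter `𝓝[>] 0`). -/
theorem exists_chamber_room {n : ℕ} {K : Set (Fin n → EuclideanSpace ℝ (Fin 4))}
    (hK : IsCompact K) (hKU : K ⊆ {x | (∀ i, 0 < x i 0) ∧ StrictMono fun i => x i 0}) :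
    ∃ δ : ℝ, 0 < δ ∧ (∀ y ∈ K, ∀ i, δ ≤ y i 0) ∧
      ∀ y ∈ K, ∀ i j, i < j → δ ≤ y j 0 - y i 0 := by
  have hc : ∀ i : Fin n, Continuous fun x : Fin n → EuclideanSpace ℝ (Fin 4) => x i 0 :=
    fun i => (EuclideanSpace.proj (0 : Fin 4)).continuous.comp (continuous_apply i)
  have h1 : ∀ i : Fin n, ∀ᶠ δ in 𝓝[>] (0 : ℝ), ∀ y ∈ K, δ ≤ y i 0 := by
    intro i
    obtain ⟨a, ha0, ha⟩ := hK.exists_forall_le' (hc i).continuousOn fun y hy => (hKU hy).1 i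
    filter_upwards [Ioc_mem_nhdsGT ha0] with δ hδ y hy using hδ.2.trans (ha y hy)
  have h2 : ∀ i j : Fin n, ∀ᶠ δ in 𝓝[>] (0 : ℝ), i < j → ∀ y ∈ K, δ ≤ y j 0 - y i 0 := by
    intro i j
    by_cases hij : i < j
    · obtain ⟨a, ha0, ha⟩ := hK.exists_forall_le' ((hc j).sub (hc i)).continuousOn
        fun y hy => sub_pos.2 ((hKU hy).2 hij)
      filter_upwards [Ioc_mem_nhdsGT ha0] with δ hδ _ y hy using hδ.2.trans (ha y hy)
    · exact Eventually.of_forall fun δ h => absurd h hij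
  have h0 : ∀ᶠ δ in 𝓝[>] (0 : ℝ), 0 < δ :=
    eventually_mem_nhdsWithin.mono fun δ hδ => mem_Ioi.1 hδ
  obtain ⟨δ, hδ0, hδ1, hδ2⟩ := (h0.and ((eventually_all.2 h1).and
    (eventually_all.2 fun i => eventually_all.2 (h2 i)))).exists
  exact ⟨δ, hδ0, fun y hy i => hδ1 i y hy, fun y hy i j hij => hδ2 i j hij y hy⟩

/-- **One piece.** A test function supported in the closed box of half-side `ε` around a point
`y₀` with room `2ε < y₀ᵢ⁰` and `y₀ᵢ⁰ + 2ε < y₀ⱼ⁰ - 2ε` (`i < j`) lies in the closed span of the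
windowed tensor products: the local density theorem `mem_closure_span_boxTensors` for the outer
open box of half-side `2ε` (block coordinates `Λ = id`, the four coordinates of each point), whose
box tensors are windowed with `aᵢ = y₀ᵢ⁰ - 2ε`, `bᵢ = y₀ᵢ⁰ + 2ε`, `ρ = ‖y₀‖ + 2ε`. -/
theorem mem_closure_span_windowed_of_box {n : ℕ}
    (P : 𝓢((Fin n → EuclideanSpace ℝ (Fin 4)), ℂ)) (y₀ : Fin n → EuclideanSpace ℝ (Fin 4))
    {ε : ℝ} (h0 : ∀ i, 2 * ε < y₀ i 0)
    (hsep : ∀ i j, i < j → y₀ i 0 + 2 * ε < y₀ j 0 - 2 * ε)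
    (hP : ∀ v ∈ tsupport (P : (Fin n → EuclideanSpace ℝ (Fin 4)) → ℂ), ∀ i c,
      |v i c - y₀ i c| ≤ ε) (hε : 0 < ε) :
    P ∈ closure ((Submodule.span ℂ
      {G : 𝓢((Fin n → EuclideanSpace ℝ (Fin 4)), ℂ) |
        ∃ (f : Fin n → 𝓢(EuclideanSpace ℝ (Fin 4), ℂ)) (a b : Fin n → ℝ) (ρ : ℝ),
        (∀ i, 0 < a i) ∧ (∀ i j, i < j → b i < a j) ∧
        (∀ i, tsupport (f i : EuclideanSpace ℝ (Fin 4) → ℂ) ⊆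
          {x | a i ≤ x 0 ∧ x 0 ≤ b i ∧ |x 1| ≤ ρ}) ∧
        IsTensorOf G f} : Submodule ℂ 𝓢((Fin n → EuclideanSpace ℝ (Fin 4)), ℂ)) :
      Set 𝓢((Fin n → EuclideanSpace ℝ (Fin 4)), ℂ)) := by
  let B : BoxData n 4 :=
    { l := fun ic => y₀ ic.1 ic.2 - 2 * ε, u := fun ic => y₀ ic.1 ic.2 + 2 * ε
      l' := fun ic => y₀ ic.1 ic.2 - ε, u' := fun ic => y₀ ic.1 ic.2 + ε
      hl := fun _ => by linarith, hl' := fun _ => by linarith, hu := fun _ => by linarith }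
  let Λ : EuclideanSpace ℝ (Fin 4) ≃L[ℝ] EuclideanSpace ℝ (Fin 4) :=
    ContinuousLinearEquiv.refl ℝ _
  have hF' : tsupport (P : (Fin n → EuclideanSpace ℝ (Fin 4)) → ℂ) ⊆
      {v | ∀ ic : Fin n × Fin 4, (Λ (v ic.1)) ic.2 ∈ Icc (B.l' ic) (B.u' ic)} := by
    intro v hv ic
    have h := abs_le.1 (hP v hv ic.1 ic.2)
    change v ic.1 ic.2 ∈ Icc (y₀ ic.1 ic.2 - ε) (y₀ ic.1 ic.2 + ε)
    constructor <;> linarith [h.1, h.2]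
  refine closure_mono (Submodule.span_mono ?_) (mem_closure_span_boxTensors Λ B P hF')
  rintro G ⟨g, hg, hG⟩
  refine ⟨fun i => ofRealTest (g i), fun i => y₀ i 0 - 2 * ε, fun i => y₀ i 0 + 2 * ε,
    ‖y₀‖ + 2 * ε, fun i => by linarith [h0 i], fun i j hij => hsep i j hij,
    fun i x hx => ?_, hG⟩
  have hx' : x ∈ tsupport (g i : EuclideanSpace ℝ (Fin 4) → ℝ) :=
    tsupport_comp_subset (g := fun t : ℝ => (t : ℂ)) Complex.ofReal_zero _ hx
  have hx0 := hg i hx' 0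
  have hx1 := hg i hx' 1
  change x 0 ∈ Ioo (y₀ i 0 - 2 * ε) (y₀ i 0 + 2 * ε) at hx0
  change x 1 ∈ Ioo (y₀ i 1 - 2 * ε) (y₀ i 1 + 2 * ε) at hx1
  have hy1 : |y₀ i 1| ≤ ‖y₀‖ :=
    calc |y₀ i 1| = ‖y₀ i 1‖ := (Real.norm_eq_abs _).symm
      _ ≤ ‖y₀ i‖ := PiLp.norm_apply_le _ _
      _ ≤ ‖y₀‖ := norm_le_pi_norm y₀ i
  refine ⟨hx0.1.le, hx0.2.le, ?_⟩
  have h' := abs_le.1 hy1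
  rw [abs_le]
  constructor <;> linarith [hx1.1, hx1.2, h'.1, h'.2]

/-- **Compactly supported functions in the chamber.** A test function with compact support inside
the open chamber lies in the closed span of the windowed tensor products: with the room `δ` of
`exists_chamber_room` and the lattice partition of unity `latticeBump` of mesh so fine that the
supports of its bumps have diameter `< δ / 5` (`dist_lt_of_mem_tsupport_latticeBump_scaled`),
`P = ∑_β η_β P` with finitely many terms (the bumps sum to `1` on the support,
`sum_latticeCube_latticeBump`, `latticeWindow_eq_one`), each piece is supported within `δ / 5` of a
point of the chamber and is handled by `mem_closure_span_windowed_of_box`, and the closure of a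
submodule is closed under finite sums. -/
theorem mem_closure_span_windowed_of_hasCompactSupport {n : ℕ}
    (P : 𝓢((Fin n → EuclideanSpace ℝ (Fin 4)), ℂ))
    (hPc : HasCompactSupport (P : (Fin n → EuclideanSpace ℝ (Fin 4)) → ℂ))
    (hPU : tsupport (P : (Fin n → EuclideanSpace ℝ (Fin 4)) → ℂ) ⊆
      {x | (∀ i, 0 < x i 0) ∧ StrictMono fun i => x i 0}) :
    P ∈ closure ((Submodule.span ℂ
      {G : 𝓢((Fin n → EuclideanSpace ℝ (Fin 4)), ℂ) |
        ∃ (f : Fin n → 𝓢(EuclideanSpace ℝ (Fin 4), ℂ)) (a b : Fin n → ℝ) (ρ : ℝ),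
        (∀ i, 0 < a i) ∧ (∀ i j, i < j → b i < a j) ∧
        (∀ i, tsupport (f i : EuclideanSpace ℝ (Fin 4) → ℂ) ⊆
          {x | a i ≤ x 0 ∧ x 0 ≤ b i ∧ |x 1| ≤ ρ}) ∧
        IsTensorOf G f} : Submodule ℂ 𝓢((Fin n → EuclideanSpace ℝ (Fin 4)), ℂ)) :
      Set 𝓢((Fin n → EuclideanSpace ℝ (Fin 4)), ℂ)) := by
  classical
  set K : Set (Fin n → EuclideanSpace ℝ (Fin 4)) :=
    tsupport (P : (Fin n → EuclideanSpace ℝ (Fin 4)) → ℂ) with hK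
  have hKc : IsCompact K := hPc
  obtain ⟨δ, hδ0, hδ1, hδ2⟩ := exists_chamber_room hKc hPU
  set ε : ℝ := δ / 5 with hεdef
  have hε : 0 < ε := by positivity
  -- linear coordinates at a scale finer than `ε`
  set m : ℕ := Module.finrank ℝ (Fin n → EuclideanSpace ℝ (Fin 4)) with hm
  let Λ₀ : (Fin n → EuclideanSpace ℝ (Fin 4)) ≃L[ℝ] EuclideanSpace ℝ (Fin m) :=
    ContinuousLinearEquiv.ofFinrankEq (by simp [hm])
  set A : ℝ := ‖(Λ₀.symm : EuclideanSpace ℝ (Fin m) →L[ℝ] (Fin n → EuclideanSpace ℝ (Fin 4)))‖ *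
    (√m * 2) with hA
  have hA0 : 0 ≤ A := by positivity
  set s : ℝ := (A + 1) / ε with hs
  have hspos : 0 < s := by positivity
  have hAs : A < ε * s := by
    rw [hs, mul_div_cancel₀ _ hε.ne']
    linarith
  set Λ : (Fin n → EuclideanSpace ℝ (Fin 4)) ≃L[ℝ] EuclideanSpace ℝ (Fin m) :=
    Λ₀.trans (ContinuousLinearEquiv.smulLeft (Units.mk0 s hspos.ne') :
      EuclideanSpace ℝ (Fin m) ≃L[ℝ] EuclideanSpace ℝ (Fin m)) with hΛ
  have hsmall : ∀ (β : Fin m → ℤ) (y y' : Fin n → EuclideanSpace ℝ (Fin 4)),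
      y ∈ tsupport (latticeBump Λ β) → y' ∈ tsupport (latticeBump Λ β) → dist y y' < ε :=
    fun β y y' hy hy' => dist_lt_of_mem_tsupport_latticeBump_scaled Λ₀ hspos hAs hy hy'
  -- a window equal to one on `K`
  obtain ⟨Bd, hBd⟩ : ∃ Bd : ℝ, ∀ y ∈ K, ‖y‖ ≤ Bd := by
    obtain ⟨Bd, hBd⟩ := hKc.isBounded.exists_norm_le
    exact ⟨Bd, hBd⟩
  set L : ℝ := ‖(Λ : (Fin n → EuclideanSpace ℝ (Fin 4)) →L[ℝ] EuclideanSpace ℝ (Fin m))‖ + 1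
    with hL
  have hL0 : 0 < L := by positivity
  set R : ℕ := ⌈max Bd 0 * L⌉₊ with hR
  have hwin : ∀ y ∈ K, latticeWindow Λ R y = 1 := by
    intro y hy
    refine latticeWindow_eq_one Λ ?_
    rw [le_div_iff₀ hL0]
    calc ‖y‖ * L ≤ max Bd 0 * L := by
          gcongr
          exact (hBd y hy).trans (le_max_left _ _)
      _ ≤ R := Nat.le_ceil _
  -- the pieces `η_β P`
  set η : (Fin m → ℤ) → (Fin n → EuclideanSpace ℝ (Fin 4)) → ℂ :=
    fun β y => ((latticeBump Λ β y : ℝ) : ℂ) with hη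
  have hηt : ∀ β, (η β).HasTemperateGrowth := fun β => hasTemperateGrowth_latticeBumpC Λ β
  set G : (Fin m → ℤ) → 𝓢((Fin n → EuclideanSpace ℝ (Fin 4)), ℂ) :=
    fun β => SchwartzMap.smulLeftCLM ℂ (η β) P with hG
  have hGapply : ∀ β y, G β y = η β y * P y := fun β y => by
    rw [hG]; exact SchwartzMap.smulLeftCLM_apply_apply (hηt β) P y
  have hGsupp : ∀ β, tsupport (G β : (Fin n → EuclideanSpace ℝ (Fin 4)) → ℂ) ⊆
      K ∩ tsupport (latticeBump Λ β) := fun β => by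
    have h := SchwartzMap.tsupport_smulLeftCLM_subset (F := ℂ) (η β) P
    rw [tsupport_latticeBumpC Λ β] at h
    exact h
  -- pointwise decomposition `P = ∑_{β ∈ cube} η_β P`
  have hsum : ∀ y, P y = ∑ β ∈ latticeCube m R, G β y := by
    intro y
    simp_rw [hGapply, ← Finset.sum_mul]
    by_cases hy : y ∈ K
    · have h1 : ∑ β ∈ latticeCube m R, η β y = 1 := by
        rw [hη]
        simp only
        rw [← Complex.ofReal_sum, sum_latticeCube_latticeBump Λ R y, hwin y hy, Complex.ofReal_one]
      rw [h1, one_mul]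
    · rw [image_eq_zero_of_notMem_tsupport hy, mul_zero]
  have hPsum : P = ∑ β ∈ latticeCube m R, G β := by
    ext y
    rw [hsum y]
    simp
  -- assemble: the closure of the span is closed under finite sums
  rw [hPsum, ← Submodule.topologicalClosure_coe]
  refine Submodule.sum_mem _ fun β _ => ?_
  rw [← SetLike.mem_coe, Submodule.topologicalClosure_coe]
  by_cases hne : (K ∩ tsupport (latticeBump Λ β)).Nonempty
  · obtain ⟨y₀, hy₀K, hy₀β⟩ := hne
    refine mem_closure_span_windowed_of_box (G β) y₀ (fun i => ?_) (fun i j hij => ?_) ?_ hε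
    · linarith [hδ1 y₀ hy₀K i]
    · linarith [hδ2 y₀ hy₀K i j hij]
    · intro v hv i c
      have hv' := hGsupp β hv
      have hd : dist y₀ v < ε := hsmall β y₀ v hy₀β hv'.2
      calc |v i c - y₀ i c| = |(v - y₀) i c| := by simp
        _ = ‖(v - y₀) i c‖ := (Real.norm_eq_abs _).symm
        _ ≤ ‖(v - y₀) i‖ := PiLp.norm_apply_le _ _
        _ ≤ ‖v - y₀‖ := norm_le_pi_norm _ i
        _ ≤ ε := by rw [← dist_eq_norm, dist_comm]; exact hd.le
  · have hzero : G β = 0 := by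
      ext y
      have hy : y ∉ tsupport (G β : (Fin n → EuclideanSpace ℝ (Fin 4)) → ℂ) :=
        fun h => hne ⟨y, hGsupp β h⟩
      exact image_eq_zero_of_notMem_tsupport hy
    rw [hzero]
    exact subset_closure (Submodule.zero_mem _)

/-- **Stub 3b — WINDOWED DENSITY: windowed tensor products span the time-ordered test functions**
(pure Schwartz-space statement). Every time-ordered `n`-point test function
(`tsupport F ⊆ {0 < x₁⁰ < ⋯ < xₙ⁰}`) lies in the closure (Schwartz topology) of the `ℂ`-span of the
windowed tensor products `G = f₁ ⊗ ⋯ ⊗ fₙ` whose factors are supported in slabs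
`{aᵢ ≤ x⁰ ≤ bᵢ, |x¹| ≤ ρ}` with `0 < aᵢ` and `bᵢ < aⱼ` for `i < j`. Proof: the compact cutoffs
`u j → F` (`exists_tsupport_subset_inter_closedBall_tendsto`) are supported in compact subsets of
the open chamber, so `mem_closure_span_windowed_of_hasCompactSupport` applies to each, and the
closure is closed. -/
theorem stub_windowedDensity {n : ℕ} (F : 𝓢((Fin n → E4), ℂ)) (hF : IsTimeOrdered F) :
    F ∈ closure ((Submodule.span ℂ
      {G : 𝓢((Fin n → E4), ℂ) | ∃ (f : Fin n → 𝓢(E4, ℂ)) (a b : Fin n → ℝ) (ρ : ℝ),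
        (∀ i, 0 < a i) ∧ (∀ i j, i < j → b i < a j) ∧
        (∀ i, tsupport (f i : E4 → ℂ) ⊆ {x | a i ≤ x 0 ∧ x 0 ≤ b i ∧ |x 1| ≤ ρ}) ∧
        IsTensorOf G f} : Submodule ℂ 𝓢((Fin n → E4), ℂ)) : Set 𝓢((Fin n → E4), ℂ)) := by
  obtain ⟨u, hu, hlim⟩ := exists_tsupport_subset_inter_closedBall_tendsto F
  refine isClosed_closure.mem_of_tendsto hlim (Eventually.of_forall fun j => ?_)
  refine mem_closure_span_windowed_of_hasCompactSupport (u j) ?_ fun x hx => hF (hu j hx).1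
  exact IsCompact.of_isClosed_subset (isCompact_closedBall _ _) (isClosed_tsupport _)
    fun x hx => (hu j hx).2

end Summit.QuantumFields.YangMills.Cruxes.PlanarSpectralCone.PositivityDiscToOperatorCone
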